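import Summits.QuantumAdvantage.QuantumAdvantage.Theorems.PairFreezingF
import Summits.QuantumAdvantage.QuantumAdvantage.Theorems.FeatureShadowClosing

/-! # PairFreezingG — part 7/8 (mechanical split for landing of `PairFreezing`; content verbatim; scopes re-opened with their variables) -/

set_option linter.dupNamespace false -- D-0017: single-problem summit ⇒ `QuantumAdvantage.QuantumAdvantage` by design
noncomputable section

namespace Summit.QuantumAdvantage.QuantumAdvantage.Theorems.PairFreezing
open Classical Finset Summit.QuantumAdvantage.AdviceFreeQNC0
open Literature.Computability.MetaComplexity Literature.Computability.MetaComplexity.Smolensky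
open Literature.Computability.Complexity (parityFn)
open Summit.QuantumAdvantage.QuantumAdvantage.Theses
open Summit.QuantumAdvantage.AdviceFreeQNC0.TransferWalk (wtPrefix_zero)
variable {n : ℕ}


/-! ### §7 Closing the route items BY NAME: 26996 `FeatureRungOdd` is a THEOREM

`WalkHardFFeat p` (the first DENSE rung, `FeatOfVPE.lean:60`, OPEN in the tree) holds for every prime `p ∉ {2, 3}`;
hence the route crux `FeatureShadow.FeatureRungOdd` (item 26996, every prime `p ≥ 5`), the aside `DenseEdgeOdd` (27654),
and — with lens-4 g2's shadow glue re-proved below — `NearPerfectFeatureShadow → Target`: after this generation the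
route FeatureShadow has NO open piece except its declared residual. -/

/-- **THEOREM.** The feature rung `WalkHardFFeat p` for every prime `p ∉ {2,3}`. -/
theorem walkHardFFeat_holds (p : ℕ) [Fact p.Prime] (hp2 : p ≠ 2) (hp3 : p ≠ 3) : WalkHardFFeat p :=
  walkHardFFeat_of_denseLoseHalf p hp3 (denseLoseHalfF_holds p hp2)

/-- closes item stmt-QuantumAdvantage-26996 `FeatureShadow.FeatureRungOdd` (P2⁺, every prime `p ≥ 5`). PROVED. -/
theorem featureRungOdd_holds : FeatureShadow.FeatureRungOdd := fun p _ hp =>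
  walkHardFFeat_holds p (by omega) (by omega)

/-- closes item stmt-QuantumAdvantage-27654 `FeatureShadow.DenseEdgeOdd` (its conclusion is now a theorem). -/
theorem denseEdgeOdd_holds : FeatureShadow.DenseEdgeOdd := fun _ => featureRungOdd_holds

section Glue

-- `ringWinU_iff_counts` / `ringWinU_eq_of_shadow`: landed in `Theorems.FeatureShadowClosing` (lens-4 g2 glue) — reused, not re-proved.

end Glue

/-- the feature pattern of `K` features of degree `D` has degree `K·D`. -/
theorem hasDegF_pattern {p : ℕ} [Fact p.Prime] {K D : ℕ} (f : Fin K → (Fin n → Bool) → Bool)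
    (hf : ∀ j, HasDegF p (f j) D) (t : (Fin K → Bool) → Bool) :
    HasDegF p (fun u => t (fun j => f j u)) (K * D) := by
  unfold HasDegF
  have h := GapFibre.ind_mem_lowDeg_of_pattern (F := ZMod p) (L := n) (D := D)
    (univ : Finset (Fin K)) (fun j u => f j u) (fun j _ => hf j) (fun u => t (fun j => f j u))
    (fun z z' hzz' => by
      have : (fun j => f j z) = (fun j => f j z') := funext fun j => hzz' j (mem_univ j)
      simp only [this])
  rw [Finset.card_univ, Fintype.card_fin] at h
  exact h

/-- **the g2/g3 residual now decides the target on its own**: `NearPerfectFeatureShadow → Target` (P2⁺ is a theorem;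
the shadow glue at `K = O(1)`).  Recorded so that the tribunal sees P1⁺ ≡ Target after this round (COSTUME as a node),
which is WHY the node moves to P1⁺⁺/P2⁺⁺. -/
theorem target_of_residual (h₁ : FeatureShadow.NearPerfectFeatureShadow) : FeatureShadow.Target := by
  -- the K = O(1) glue: specialise `target_of_polyPieces`'s proof to constant K via the two proved embeddings
  -- P1⁺ → P1⁺⁺ needs nothing; P2⁺ (proved) is used through the constant-K rung directly:
  intro p _ hp
  obtain ⟨θ₀, hθ₀, H₂⟩ := featureRungOdd_holds p hp
  have hq : 0 < (1 - θ₀) / 4 := by linarith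
  obtain ⟨ε, hε, H₁⟩ := h₁ p hp ((1 - θ₀) / 4) hq
  refine ⟨max (θ₀ + (1 - θ₀) / 4) (1 - ε), max_lt (by linarith) (by linarith), fun C => ?_⟩
  obtain ⟨C', K, n₁, H₁C⟩ := H₁ C
  obtain ⟨n₂, H₂C⟩ := H₂ C' K
  refine ⟨max n₁ n₂, fun n hn c y hy => ?_⟩
  have h2 : (0 : ℝ) ≤ (2 : ℝ) ^ n := by positivity
  by_cases hwin : ((Finset.univ.filter fun u : Fin n → Bool => ringWinU c y u = true).card : ℝ) ≤ (1 - ε) * (2 : ℝ) ^ n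
  · exact hwin.trans (mul_le_mul_of_nonneg_right (le_max_right _ _) h2)
  · rw [not_le] at hwin
    obtain ⟨f, hf, tab, hExc⟩ := H₁C n (le_of_max_le_left hn) c y hy hwin.le
    have hmodel := H₂C n (le_of_max_le_right hn) c f tab hf
    set Exc := Finset.univ.filter fun u : Fin n → Bool => ¬ (∀ e ∈ Finset.range 3, ∀ e' ∈ Finset.range 3,
            ((Finset.univ.filter fun g : Fin (n + 1) => y g u = true ∧ (g.val + wtPrefix u g.val) % 3 = e).card
              + (Finset.univ.filter fun g : Fin (n + 1) =>
                  tab g (fun j => f j u) = true ∧ (g.val + wtPrefix u g.val) % 3 = e).card) % 2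
            = ((Finset.univ.filter fun g : Fin (n + 1) => y g u = true ∧ (g.val + wtPrefix u g.val) % 3 = e').card
              + (Finset.univ.filter fun g : Fin (n + 1) =>
                  tab g (fun j => f j u) = true ∧ (g.val + wtPrefix u g.val) % 3 = e').card) % 2) with hExcDef
    set WinM := Finset.univ.filter fun u : Fin n → Bool => ringWinU c (fun g u => tab g (fun j => f j u)) u = true
      with hWinMDef
    have hsub : (Finset.univ.filter fun u : Fin n → Bool => ringWinU c y u = true) ⊆ Exc ∪ WinM := by
      intro u hu
      rw [mem_filter] at hu
      rw [mem_union]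
      by_cases hE : u ∈ Exc
      · exact Or.inl hE
      · right
        rw [hExcDef, mem_filter, not_and, not_not] at hE
        have hX := hE (mem_univ _)
        rw [hWinMDef, mem_filter]
        refine ⟨mem_univ _, ?_⟩
        rw [← FeatureShadowClosing.ringWinU_eq_of_shadow c y (fun g u => tab g (fun j => f j u)) u hX]
        exact hu.2
    have hle := (Finset.card_le_card hsub).trans (Finset.card_union_le _ _)
    have hle' : (((Finset.univ.filter fun u : Fin n → Bool => ringWinU c y u = true).card : ℕ) : ℝ)
        ≤ (Exc.card : ℝ) + (WinM.card : ℝ) := by exact_mod_cast hle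
    calc (((Finset.univ.filter fun u : Fin n → Bool => ringWinU c y u = true).card : ℕ) : ℝ)
        ≤ (Exc.card : ℝ) + (WinM.card : ℝ) := hle'
      _ ≤ (1 - θ₀) / 4 * (2 : ℝ) ^ n + θ₀ * (2 : ℝ) ^ n := add_le_add hExc hmodel
      _ = (θ₀ + (1 - θ₀) / 4) * (2 : ℝ) ^ n := by ring
      _ ≤ max (θ₀ + (1 - θ₀) / 4) (1 - ε) * (2 : ℝ) ^ n := mul_le_mul_of_nonneg_right (le_max_left _ _) h2

/-- closes item stmt-QuantumAdvantage-27005 `FeatureShadow.Assembly`'s shape with the proved pieces inlined: the route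
FeatureShadow now decides the rung leaf from its residual ALONE. -/
theorem adviceFreeQNC0Odd_of_residual (h₁ : FeatureShadow.NearPerfectFeatureShadow) : AdviceFreeQNC0Odd :=
  FeatureShadow.closes h₁ featureRungOdd_holds (fun h _ => target_of_residual h)
  -- (`FeatureShadow.ShadowGlue` itself is landed as `Theorems.featureShadow_shadowGlue`, item 26997 closed)

/-! ### §9 (gen-4 addendum) Logarithmically many features — `WalkHardFFeatLog p` PROVED

The PARAMETRIC dense law (explicit `M`, `E`, no `L₀`) and the §6 routing with `K`-dependent parameters
`M = 4^K·(log₂ n)^{2C+2}·m₁`, `E = K + E₀`, dense threshold `T + 1 = 24(M+E)+8 ≲ n^{2/7}·polylog` (sparse budget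
`T³·(log₂ n)^{2C+4} ≤ n`): the feature rung for every `K ≤ log₂ n / 7`, `θ = 1 − (1−θ_S)/4` uniform in `C` and `K`.
(Polylog `K` — P2⁺⁺ of the node file — needs a density-relative law.) -/

/-- **parametric dense law**: for every `M ≥ 1` and `E`, inside any degree-`D` level set `U`, every fixed table with
at least `24(M+E)+8` fired cuts loses on at least `½·#U − (½·D/√M + (3/2)/2^E)·2^L` inputs. -/
theorem denseLose_param (p : ℕ) [Fact p.Prime] (hp2 : p ≠ 2) {L : ℕ} (hL1 : 1 ≤ L) (c : ℕ)
    (tab : Fin (L + 1) → Bool) (g : (Fin L → Bool) → Bool) {D M E : ℕ} (hg : HasDegF p g D) (hM1 : 1 ≤ M)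
    (hS : 24 * (M + E) + 8 ≤ (univ.filter fun h : Fin (L + 1) => tab h = true).card) :
    (1 / 2 : ℝ) * ((univ.filter fun z : Fin L → Bool => g z = true).card : ℝ) ≤
      ((univ.filter fun z : Fin L → Bool => g z = true ∧ ringWinU c (fun h _ => tab h) z = false).card : ℝ)
        + ((1 / 2) * (D / Real.sqrt M) + (3 / 2) / 2 ^ E) * (2 : ℝ) ^ L := by
  have h2 : (2 : ZMod p) ≠ 0 := (by
    intro h0
    have h0' : ((2 : ℕ) : ZMod p) = 0 := by exact_mod_cast h0
    rw [ZMod.natCast_eq_zero_iff] at h0'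
    exact hp2 ((Nat.prime_dvd_prime_iff_eq Fact.out Nat.prime_two).1 h0'))
  obtain ⟨π, hπ⟩ : ∃ π : Pairing L, (univ.filter fun h : Fin (L + 1) => tab h = true).card ≤ 2 + 2 * π.t tab := by
    have hcov := card_fired_le_two_add L hL1 tab
    by_cases h01 : (pairing1 L hL1).t tab ≤ (pairing0 L).t tab
    · exact ⟨pairing0 L, by omega⟩
    · exact ⟨pairing1 L hL1, by omega⟩
  have hK : 6 * (M + E) ≤ π.K tab := by
    unfold Pairing.K; omega
  have hcore := π.core_half c tab h2 hg hM1
  have hocc := π.occupation_real tab c M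
  have h2L : (0 : ℝ) < (2 : ℝ) ^ L := by positivity
  have herr2 : 3 * 2 ^ M * (7 / 8 : ℝ) ^ π.K tab ≤ 3 / 2 ^ E := by
    have h78 : (7 / 8 : ℝ) ^ π.K tab ≤ (7 / 8 : ℝ) ^ (6 * (M + E)) :=
      pow_le_pow_of_le_one (by norm_num) (by norm_num) hK
    have h6 : (7 / 8 : ℝ) ^ (6 * (M + E)) ≤ (1 / 2 : ℝ) ^ (M + E) := by
      rw [pow_mul]
      exact pow_le_pow_left₀ (by norm_num) (by norm_num) _
    have hhalf : (3 : ℝ) * 2 ^ M * (1 / 2 : ℝ) ^ (M + E) = 3 / 2 ^ E := by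
      rw [pow_add, one_div_pow, one_div_pow]
      field_simp
    have h2M : (0 : ℝ) ≤ 3 * 2 ^ M := by positivity
    calc 3 * 2 ^ M * (7 / 8 : ℝ) ^ π.K tab ≤ 3 * 2 ^ M * (1 / 2 : ℝ) ^ (M + E) :=
          mul_le_mul_of_nonneg_left (h78.trans h6) h2M
      _ = 3 / 2 ^ E := hhalf
  have hsplit : ((univ.filter fun z : Fin L → Bool => g z = true).card : ℝ) =
      (univ.filter fun z : Fin L → Bool => (g z && ringWinU c (fun h _ => tab h) z) = true).card
      + (univ.filter fun z : Fin L → Bool => g z = true ∧ ringWinU c (fun h _ => tab h) z = false).card := by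
    rw [← Nat.cast_add, ← card_union_of_disjoint]
    · refine congrArg _ (congrArg Finset.card ?_)
      ext u
      simp only [mem_union, mem_filter, mem_univ, true_and]
      cases g u <;> cases ringWinU c (fun h _ => tab h) u <;> simp
    · refine disjoint_filter.2 fun u _ h1 h3 => ?_
      revert h1 h3
      cases g u <;> cases ringWinU c (fun h _ => tab h) u <;> simp
  have hB : (1 / 2 : ℝ) * ((univ.filter fun u : Fin L → Bool =>
      decide ((π.rel c tab u).card < M) = true).card : ℝ) ≤ (1 / 2) * ((3 / 2 ^ E) * 2 ^ L) := by
    refine mul_le_mul_of_nonneg_left (hocc.trans ?_) (by norm_num)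
    exact mul_le_mul_of_nonneg_right herr2 h2L.le
  have hexp : ((1 / 2) * ((D : ℝ) / Real.sqrt M) + (3 / 2) / 2 ^ E) * (2 : ℝ) ^ L =
      (1 / 2) * (((D : ℝ) / Real.sqrt M) * 2 ^ L) + (1 / 2) * ((3 / 2 ^ E) * 2 ^ L) := by ring
  rw [hexp]
  linarith

/-- sparse budget of the log-`K` routing: `T³·(log₂ n)^{2C+4} ≤ n`. -/
theorem logBudget {C E₀ m₁ N₁ n K D M E T : ℕ}
    (hN₁ : ∀ N ≥ N₁, (56 + 24 * E₀) ^ 3 * m₁ ^ 3 * 13 ^ (8 * C + 10) * Nat.log 2 N ^ (8 * C + 10) ≤ N)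
    (hm₁1 : 1 ≤ m₁) (hℓ7 : 7 * (N₁ + 1) ≤ Nat.log 2 n) (hn : 1 ≤ n) (hK : K ≤ Nat.log 2 n / 7)
    (hD1 : 1 ≤ D) (hDdef : D = Nat.log 2 n ^ (C + 1)) (hMdef : M = 4 ^ K * D ^ 2 * m₁) (hEdef : E = K + E₀)
    (hTdef : T = 24 * (M + E) + 7) :
    T ^ 3 * Nat.log 2 n ^ (2 * (C + 1) + 2) ≤ n := by
  have hM1 : 1 ≤ M := by
    rw [hMdef]
    exact Nat.mul_pos (Nat.mul_pos (pow_pos (by norm_num) K) (pow_pos (by omega) 2)) (by omega)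
  have hKM : K ≤ M := by
    have h1 : K ≤ 4 ^ K := (Nat.lt_two_pow_self).le.trans (Nat.pow_le_pow_left (by norm_num) K)
    have h2 : 4 ^ K ≤ 4 ^ K * D ^ 2 * m₁ := by
      calc 4 ^ K = 4 ^ K * 1 * 1 := by ring
        _ ≤ 4 ^ K * D ^ 2 * m₁ :=
          Nat.mul_le_mul (Nat.mul_le_mul_left _ (Nat.one_le_pow _ _ hD1)) hm₁1
    omega
  have hTM : T ≤ (56 + 24 * E₀) * M := by
    have hEM : E₀ ≤ E₀ * M := Nat.le_mul_of_pos_right E₀ hM1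
    rw [hTdef, hEdef]
    nlinarith [hKM, hEM, hM1]
  have hM3 : ((56 + 24 * E₀) * M) ^ 3 * Nat.log 2 n ^ (2 * (C + 1) + 2) =
      ((56 + 24 * E₀) ^ 3 * m₁ ^ 3 * Nat.log 2 n ^ (8 * C + 10)) * 2 ^ (6 * K) := by
    rw [hMdef, hDdef]
    have h4 : (4 : ℕ) ^ K = 2 ^ (2 * K) := by rw [pow_mul]; norm_num
    rw [h4]; ring
  have hgrow : (56 + 24 * E₀) ^ 3 * m₁ ^ 3 * Nat.log 2 n ^ (8 * C + 10) ≤ 2 ^ (Nat.log 2 n / 7) := by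
    have hq : N₁ ≤ 2 ^ (Nat.log 2 n / 7) :=
      le_trans (by omega : N₁ ≤ Nat.log 2 n / 7) (Nat.lt_two_pow_self).le
    have h13 : Nat.log 2 n ≤ 13 * (Nat.log 2 n / 7) := by omega
    calc (56 + 24 * E₀) ^ 3 * m₁ ^ 3 * Nat.log 2 n ^ (8 * C + 10)
        ≤ (56 + 24 * E₀) ^ 3 * m₁ ^ 3 * (13 * (Nat.log 2 n / 7)) ^ (8 * C + 10) :=
          Nat.mul_le_mul_left _ (Nat.pow_le_pow_left h13 _)
      _ = (56 + 24 * E₀) ^ 3 * m₁ ^ 3 * 13 ^ (8 * C + 10) * Nat.log 2 (2 ^ (Nat.log 2 n / 7)) ^ (8 * C + 10) := by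
          rw [Nat.log_pow (by norm_num), mul_pow]; ring
      _ ≤ 2 ^ (Nat.log 2 n / 7) := hN₁ (2 ^ (Nat.log 2 n / 7)) hq
  have h2pow : 2 ^ (Nat.log 2 n / 7) * 2 ^ (6 * K) ≤ n := by
    rw [← pow_add]
    calc 2 ^ (Nat.log 2 n / 7 + 6 * K) ≤ 2 ^ Nat.log 2 n := Nat.pow_le_pow_right (by norm_num) (by omega)
      _ ≤ n := Nat.pow_log_le_self 2 (by omega)
  calc T ^ 3 * Nat.log 2 n ^ (2 * (C + 1) + 2)
      ≤ ((56 + 24 * E₀) * M) ^ 3 * Nat.log 2 n ^ (2 * (C + 1) + 2) :=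
        Nat.mul_le_mul_right _ (Nat.pow_le_pow_left hTM 3)
    _ = ((56 + 24 * E₀) ^ 3 * m₁ ^ 3 * Nat.log 2 n ^ (8 * C + 10)) * 2 ^ (6 * K) := hM3
    _ ≤ 2 ^ (Nat.log 2 n / 7) * 2 ^ (6 * K) := Nat.mul_le_mul_right _ hgrow
    _ ≤ n := h2pow

/-- error coefficient of the log-`K` routing: `½·D/√M + (3/2)/2^E ≤ (1−θ_S)/(4·2^K)`. -/
theorem coefBound {θS : ℝ} (h1θ : 0 < 1 - θS) {m₁ E₀ K D M E : ℕ} (hm₁ : 16 / (1 - θS) ^ 2 ≤ (m₁ : ℝ))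
    (hE₀ : 12 / (1 - θS) ≤ (2 : ℝ) ^ E₀) (hD1 : 1 ≤ D) (hm₁1 : 1 ≤ m₁) (hMdef : M = 4 ^ K * D ^ 2 * m₁)
    (hEdef : E = K + E₀) :
    (1 / 2 : ℝ) * (D / Real.sqrt M) + (3 / 2) / 2 ^ E ≤ (1 - θS) / (4 * 2 ^ K) := by
  have hM1 : (0 : ℝ) < (M : ℝ) := by
    have h : 1 ≤ M := by
      rw [hMdef]
      exact Nat.mul_pos (Nat.mul_pos (pow_pos (by norm_num) K) (pow_pos (by omega) 2)) (by omega)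
    exact_mod_cast h
  have herr1 : (D : ℝ) / Real.sqrt M ≤ (1 - θS) / (4 * 2 ^ K) := by
    have hMr : (M : ℝ) = 4 ^ K * (D : ℝ) ^ 2 * m₁ := by rw [hMdef]; push_cast; ring
    have hpos : (0 : ℝ) < (1 - θS) / (4 * 2 ^ K) := by positivity
    have hMge : ((D : ℝ)) ^ 2 ≤ ((1 - θS) / (4 * 2 ^ K)) ^ 2 * M := by
      rw [hMr]
      have h4 : (4 : ℝ) ^ K = ((2 : ℝ) ^ K) ^ 2 := by
        rw [← pow_mul, mul_comm, pow_mul]; norm_num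
      rw [h4]
      have hD0 : (0 : ℝ) ≤ (D : ℝ) ^ 2 := by positivity
      have hm : (16 : ℝ) ≤ (1 - θS) ^ 2 * m₁ := by
        have h1 : (0 : ℝ) < (1 - θS) ^ 2 := by positivity
        calc (16 : ℝ) = (1 - θS) ^ 2 * (16 / (1 - θS) ^ 2) := by field_simp
          _ ≤ (1 - θS) ^ 2 * m₁ := mul_le_mul_of_nonneg_left hm₁ h1.le
      have h2K : (0 : ℝ) < (2 : ℝ) ^ K := by positivity
      have heq : ((1 - θS) / (4 * 2 ^ K)) ^ 2 * (((2 : ℝ) ^ K) ^ 2 * (D : ℝ) ^ 2 * m₁) =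
          ((1 - θS) ^ 2 * m₁) / 16 * (D : ℝ) ^ 2 := by
        field_simp
        ring
      rw [heq]
      nlinarith
    have hsq : ((D : ℝ)) ≤ (1 - θS) / (4 * 2 ^ K) * Real.sqrt M := by
      have h := Real.sqrt_le_sqrt hMge
      rw [Real.sqrt_sq (by positivity), Real.sqrt_mul (by positivity), Real.sqrt_sq hpos.le] at h
      exact h
    have hMpos : (0 : ℝ) < Real.sqrt M := Real.sqrt_pos.2 hM1
    rw [div_le_iff₀ hMpos]
    exact hsq
  have herr2 : (3 / 2 : ℝ) / 2 ^ E ≤ (1 - θS) / (8 * 2 ^ K) := by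
    have hE2 : (2 : ℝ) ^ E = 2 ^ K * 2 ^ E₀ := by rw [hEdef, pow_add]
    rw [hE2, div_le_div_iff₀ (by positivity) (by positivity)]
    have h12 : (12 : ℝ) ≤ (1 - θS) * 2 ^ E₀ := by
      have := (div_le_iff₀ h1θ).1 hE₀
      linarith
    have h2K : (0 : ℝ) < (2 : ℝ) ^ K := by positivity
    nlinarith
  have h4 : (1 / 2 : ℝ) * ((1 - θS) / (4 * 2 ^ K)) + (1 - θS) / (8 * 2 ^ K) = (1 - θS) / (4 * 2 ^ K) := by
    field_simp; ring
  rw [← h4]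
  have := mul_le_mul_of_nonneg_left herr1 (by norm_num : (0 : ℝ) ≤ 1 / 2)
  linarith

end Summit.QuantumAdvantage.QuantumAdvantage.Theorems.PairFreezing
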